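import Literature.NumberTheory.Automorphic.UnitaryGroupRankOneCartanAnyInvolution   -- ★ `exists_coe_eq_diagonal_uniformizer` (the twisted ray `d(ϖ, 1, (σϖ)⁻¹)`)
import Literature.NumberTheory.Automorphic.UnitaryGroupRogawskiTorusCartanForm      -- ★ `glDiagonal_mem_and_mem_glInt`
import Literature.NumberTheory.Automorphic.UnitaryGroupRankOneBigCell               -- ★ `exists_coe_eq_diag`
import HarnessLib

/-!
# The square of the twisted ray of `U(σ, Φ₃)(K)`: `d(ϖ, 1, (σϖ)⁻¹)² = d(ϖσϖ, 1, (ϖσϖ)⁻¹) · d(ϖ/σϖ, 1, ϖ/σϖ)` (rank-one kit R6-model)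

Topic `NumberTheory/Automorphic`; namespace `Literature.NumberTheory.Automorphic.UnitaryGroup`.  THEOREMS ONLY (no definition, no named fact, no
instance, no `sorry`).  Cell `hodgecm-mathlib`, F0∕P3, seat F0P3-p01 (g10): the model-side input of the RAMIFIED step of the N5 assembly (★
`CasselmanCriterionRankOne.isSquareIntegrableModCenter_of_forall_norm_exponent_lt_one_of_sq`): at a ramified quadratic `K/K^σ` the Cartan ray
`a = d(ϖ, 1, (σϖ)⁻¹)` (★ `exists_cartan_of_involution`, ANY uniformiser `ϖ`) is not of the shape `d(α, 1, ᾱ⁻¹)` with `α` `σ`-FIXED that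
Casselman's statement [Casselman1995, Thm. 4.4.6] ∕ [Rogawski1990, §12.2] quantifies over, but its square is such an element `b = d(ϖσϖ, 1, (ϖσϖ)⁻¹)`
(`σ(ϖσϖ) = ϖσϖ`, `|ϖσϖ| = |ϖ|² < 1`) times the UNIT torus element `k = d(ϖ/σϖ, 1, ϖ/σϖ) ∈ U ∩ GL₃(𝒪)` — so an exponent bound at `b` controls the
eigenvalues of `T_a` (`|χ(k)| = 1` on compact torus elements).

RESULTS: `isUnit_norm_ratio` bookkeeping, **`exists_sq_eq_admissible_mul_unit`**: for `σ` an isometric involution and `ϖ ≠ 0`, `a ∈ U` with matrix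
`diag(ϖ, 1, (σϖ)⁻¹)`, there are `b, k ∈ T` with `a² = b·k`, `b` of matrix `diag(ϖσϖ, 1, (σ(ϖσϖ))⁻¹)`, `σ(ϖσϖ) = ϖσϖ`, `k ∈ GL₃(𝒪)`; and
`v_mul_map_lt_one` (`|ϖσϖ| < 1` when `|ϖ| < 1`).

## References
* [Casselman1995] W. Casselman, *Introduction to the theory of admissible representations of `p`-adic reductive groups* (1995), Thm. 4.4.6.
* [Rogawski1990] J. D. Rogawski, *Automorphic Representations of Unitary Groups in Three Variables*, §1.10 p. 9, §12.2 p. 173.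
* [BruhatTits1972] F. Bruhat, J. Tits, *Groupes réductifs sur un corps local I*, (4.4.3).
-/

set_option autoImplicit false

open scoped MatrixGroups Pointwise Topology WithZero
open ValuativeRel Matrix

namespace Literature.NumberTheory.Automorphic

namespace UnitaryGroup

section RaySquare

variable {K : Type*} [Field K] [Valued K ℤᵐ⁰] [ValuativeRel K] [(Valued.v : Valuation K ℤᵐ⁰).Compatible]
  (σ : K →+* K) {J : Matrix (Fin 3) (Fin 3) K} (hJ : J = (StdForm.antidiagonal 3).over K)

omit [Valued K ℤᵐ⁰] [ValuativeRel K] [(Valued.v : Valuation K ℤᵐ⁰).Compatible] in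
/-- `σ(ϖ σϖ) = ϖ σϖ` for an involution `σ`. [cite: Rogawski1990, §1.10 p. 9] -/
theorem map_mul_map_self (hσσ : ∀ x, σ (σ x) = x) (ϖ : K) : σ (ϖ * σ ϖ) = ϖ * σ ϖ := by
  rw [map_mul, hσσ, mul_comm]

omit [ValuativeRel K] [(Valued.v : Valuation K ℤᵐ⁰).Compatible] in
/-- `|ϖ σϖ| < 1` when `|ϖ| < 1` and `σ` is isometric. [cite: Rogawski1990, §12.2 p. 173] -/
theorem v_mul_map_lt_one (hσv : ∀ x, Valued.v (σ x) = Valued.v x) {ϖ : K} (hϖ1 : Valued.v ϖ < 1) : Valued.v (ϖ * σ ϖ) < 1 := by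
  rw [map_mul, hσv]
  exact mul_lt_one_of_nonneg_of_lt_one_left zero_le hϖ1 hϖ1.le

include hJ in
/-- **THE SQUARE OF THE TWISTED RAY IS AN ADMISSIBLE TORUS ELEMENT TIMES A UNIT**: for `σ` an isometric involution, `ϖ ≠ 0` and `a ∈ U(σ, Φ₃)` with
matrix `diag(ϖ, 1, (σϖ)⁻¹)`, there are torus elements `b, k` with `a² = b k`, `b` of matrix `diag(ϖσϖ, 1, (σ(ϖσϖ))⁻¹)` (first entry `σ`-fixed),
and `k = diag(ϖ/σϖ, 1, ϖ/σϖ) ∈ GL₃(𝒪)` (★ `glDiagonal_mem_and_mem_glInt`). [cite: Casselman1995, Thm. 4.4.6] [cite: Rogawski1990, §1.10 p. 9; §12.2 p. 173]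
[cite: BruhatTits1972, (4.4.3)] -/
theorem exists_sq_eq_admissible_mul_unit (hσσ : ∀ x, σ (σ x) = x) (hσv : ∀ x, Valued.v (σ x) = Valued.v x) {ϖ : K} (hϖ0 : ϖ ≠ 0)
    (a : ↥(unitaryGroupOfForm σ J)) (ha : ((a : GL (Fin 3) K) : Matrix (Fin 3) (Fin 3) K) = Matrix.diagonal ![ϖ, 1, (σ ϖ)⁻¹]) :
    ∃ b k : ↥(unitaryGroupOfForm σ J), b ∈ torusU σ J ∧ k ∈ torusU σ J ∧
      ((b : GL (Fin 3) K) : Matrix (Fin 3) (Fin 3) K) = Matrix.diagonal ![ϖ * σ ϖ, 1, (σ (ϖ * σ ϖ))⁻¹] ∧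
      (k : GL (Fin 3) K) ∈ glInt 3 K ∧ a ^ 2 = b * k := by
  have hσϖ0 : σ ϖ ≠ 0 := (map_ne_zero σ).2 hϖ0
  have hα0 : ϖ * σ ϖ ≠ 0 := mul_ne_zero hϖ0 hσϖ0
  -- `b = d(ϖσϖ, 1, (σ(ϖσϖ))⁻¹)`
  obtain ⟨b, hbT, hb⟩ := exists_coe_eq_diag σ hJ hσσ hα0 (β := 1) (by rw [map_one, mul_one])
  -- `k = diag(u, 1, u)`, `u = ϖ / σϖ`, a unit of valuation one
  set u : Kˣ := Units.mk0 (ϖ * (σ ϖ)⁻¹) (mul_ne_zero hϖ0 (inv_ne_zero hσϖ0)) with hu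
  set w : Fin 3 → Kˣ := ![u, 1, u] with hw
  have hσu : σ (ϖ * (σ ϖ)⁻¹) * (ϖ * (σ ϖ)⁻¹) = 1 := by
    rw [map_mul, map_inv₀, hσσ]
    field_simp
  have hwrel : ∀ i, σ (w (Fin.rev i) : K) * (w i : K) = 1 := by
    intro i
    fin_cases i
    · simpa [hw, hu] using hσu
    · simp [hw]
    · simpa [hw, hu] using hσu
  have hvu : Valued.v (ϖ * (σ ϖ)⁻¹) = 1 := by
    rw [map_mul, map_inv₀, hσv, mul_inv_cancel₀ ((Valuation.ne_zero_iff _).2 hϖ0)]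
  have hwv : ∀ i, Valued.v (w i : K) = 1 := by
    intro i
    fin_cases i
    · simpa [hw, hu] using hvu
    · simp [hw]
    · simpa [hw, hu] using hvu
  obtain ⟨hkU, hkInt⟩ := glDiagonal_mem_and_mem_glInt σ hJ w hwrel hwv
  refine ⟨b, ⟨glDiagonal 3 K w, hkU⟩, hbT, ⟨w, rfl⟩, ?_, hkInt, ?_⟩
  · rw [hb]
    ext i j
    fin_cases i <;> fin_cases j <;> simp
  · -- the matrix identity `diag(ϖ,1,(σϖ)⁻¹)² = diag(ϖσϖ,1,(σ(ϖσϖ))⁻¹) · diag(ϖ/σϖ, 1, ϖ/σϖ)`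
    apply Subtype.ext
    apply Units.ext
    rw [Subgroup.coe_pow, Units.val_pow_eq_pow_val, ha, Subgroup.coe_mul, Units.val_mul, hb, coe_glDiagonal]
    ext i j
    fin_cases i <;> fin_cases j <;> simp [pow_two, Matrix.mul_apply, Fin.sum_univ_three, hw, hu, map_mul, hσσ]
    · field_simp
    · field_simp

end RaySquare

end UnitaryGroup

end Literature.NumberTheory.Automorphic
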